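import Summits.QuantumFields.YangMills.Theorems.CovariantDischargeSweepGapReduction
import HarnessLib

/-!
# Crux `HistoryTailL` (stmt-QuantumFields-19936), registered skeleton «sandwich_discharge» — WHAT ANY SWEEP-GAP TEXT MUST PAY:
# the action floor and the sublevel domination forced by a `dU`-preserving bijection with an action gap (necessary conditions, by kernel)

Cell `ym3-torus` (YM ladder rung R3 = continuum SU(2) Yang–Mills on the three-torus — a RUNG, NOT the Clay problem: not d = 4, not
infinite volume, not a mass gap), width seat `ym-ust-19936-w4` gen 14, helper letters `--supports stmt-QuantumFields-19936`.

The registered load-bearing stub `SandwichDischarge.stub_sandwichSweepGapCapped` of `Cruxes/HistoryTailL/Lines/sandwich_discharge.lean` (v5; v4's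
`stub_sandwichSweepGap` and the rev-0 (HGap) of `CovariantDischargeSweepGapReduction` alike) has the SHAPE «for every direction there is a `dU`-preserving measurable
bijection `(Ψ, Ψ′)` of the fine gauge fields with `m ≤ β·(A(V) − A(Ψ′V))` for every `V` in the event `E`» (`A = wilsonAction4`).  The
landed reduction turns such a gap into the tail bound `μ_β(E) ≤ e^{−m}`.  THIS FILE records, once and by kernel, what EVERY inhabitant of a
text of that shape delivers as a by-product — i.e. the necessary conditions a refuter may aim at and the ceiling on the gain constant that any
prover must respect (the cell's LOCATE «SW-GAP» #53, points (2)–(3), as theorem shapes):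

* §1 (generic `Params`, generic compact `G` with Haar datum, ANY set `E`, ANY maps `Ψ′` resp. admissible `(Ψ, Ψ′)`):
  - ★`action_floor_of_gap` — `0 ≤ β`, gap `m` on `E` ⟹ `m ≤ β·A(V)` for every `V ∈ E`: undoing the sweep cannot gain more action than the
    configuration has (`A(Ψ′V) ≥ 0`, lit `wilsonAction4_nonneg`).  In the line: `c_g·p(g_{K−j})(b₀)² − D ≤ β_K·inf_E A` — the «`c_g` ceiling».
  - `inter_sublevel_eq_empty_of_gap` (the event misses `{β·A < m}`); `mul_le_action_of_iterate_mem` / ★`exists_iterate_not_mem` — if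
    `V, Ψ′V, …, Ψ′^{k−1}V ∈ E` then `k·m ≤ β·A(V)`; for `m > 0` the `Ψ′`-orbit of every `V ∈ E` leaves `E` within `⌊β·A(V)/m⌋ + 1` steps.
  - ★★`measureReal_fieldMeasure_inter_sublevel_le_of_gap` — HAAR SUBLEVEL DOMINATION: `0 < β` ⟹ for every level `t`,
    `dU(E ∩ {A ≤ t}) ≤ dU({A ≤ t − m/β})` (`Ψ′` is `dU`-preserving too and maps the measurable gap-hull of `E ∩ {A ≤ t}` into the lower
    sublevel) — the Haar-volume comparison that decides a pure-`∃Ψ′` text, displayed at ONE level `t` so that a refuter can aim at it.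
  - ★★`measureReal_gibbsMeasure_inter_sublevel_le_of_gap` — GIBBS SUBLEVEL DOMINATION (action-localised sharpening of the landed tail
    corollary `CovariantDischargeHaarSweepReweighting.measureReal_gibbsMeasure_le_exp_neg_mul`): `μ_β(E ∩ {A ≤ t}) ≤ e^{−m}·μ_β({A ≤ t − m/β})`
    for every `t` (`t → ∞` is §1 of `CovariantDischargeSweepGapReduction`); `gibbsK` forms for a Bałaban family.
* §2 THE REGISTERED TEXT'S PRICE (`G = SU(2)`; skeleton v5, stub `stub_sandwichSweepGapCapped` — the severity-capped reshape of v4's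
  `stub_sandwichSweepGap` after the located wrap-around corner, 19936 evidence #53): ★★`actionFloor_of_sweepGapCappedText` — the registered
  signature (hypothesis, VERBATIM from `payload.stubs`) implies the same quantifier prefix with the conclusion replaced by the DETERMINISTIC ACTION
  FLOOR `c_g·p(g_{K−j})(b₀)² − D ≤ β_K·A(V)` for every `V` in the sandwich-window event; ★★`gibbsK_inter_sublevel_le_of_sweepGapCappedText` — and
  the action-localised tail `Gibbs_K(E_v ∩ {A ≤ t}) ≤ e^{D}·e^{−c_g·p²}·Gibbs_K({A ≤ t − (c_g·p² − D)/β_K})` at every level `t`.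
  Both transfer verbatim to any further reshape that keeps the `(Ψ, Ψ′)`-gap conclusion.

WHAT THIS IS NOT.  Necessary conditions only: nothing here inhabits `stub_sandwichSweepGap` (registered or reshaped) or bounds `inf_E A` from
below; nothing of the sandwich cruxes, `HistoryTailL`, rung R3, d = 4, a continuum limit or a gap is proved.  YM₃ on T³ is rung R3, NOT Clay.

References: T. Bałaban, CMP **102** (1985) 255–275 [Balaban1985UV3] ((1)–(3) p.256 the Wilson density, (7) p.257 the thresholds `p(g)`);
CMP **98** (1985) 17–51 [Balaban1985Averaging] ((10) p.19: the product Haar measure `dU`).  The measure theory is folklore.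
-/

noncomputable section

open MeasureTheory
open scoped RealInnerProductSpace
open Literature.MathematicalPhysics.QuantumLattice (su2Quat)
open Literature.MathematicalPhysics.QuantumFieldTheory.Balaban1983to89
open Literature.MathematicalPhysics.QuantumFieldTheory.Balaban1983to89.Missing (measurable_wilsonAction4 isProbabilityMeasure_fieldMeasure)
open Literature.MathematicalPhysics.QuantumFieldTheory.Balaban1983to89.T3ContinuumYM3Torus
open Literature.MathematicalPhysics.QuantumFieldTheory.Balaban1983to89.T3UnitScaleTilt
open Literature.MathematicalPhysics.QuantumFieldTheory.Balaban1983to89.T3UnitLawDensityEML (ℰp)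
open Literature.MathematicalPhysics.QuantumFieldTheory.Balaban1983to89.T4CubeChartGnomonic (SU2)
open Literature.MathematicalPhysics.QuantumFieldTheory.Balaban1983to89.T4ExpWindowSmallField (imVec)
open Summit.QuantumFields.YangMills.Theorems.CovariantDischargeHaarSweepReweighting

namespace Summit.QuantumFields.YangMills.Theorems.CovariantDischargeSweepGapNecessary

/-! ## §1 Generic necessary conditions of an action gap under a `dU`-preserving bijection -/

section Floor

variable {P : Params} {G : Type*} [GaugeGroup G]

/-- **THE ACTION FLOOR.**  If undoing a map `Ψ′` lowers `β·A` by at least `m` on the event `E` (`m ≤ β(A(V) − A(Ψ′V))` for `V ∈ E`,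
`β ≥ 0`), then `m ≤ β·A(V)` on `E`: the gain is paid out of the configuration's own (non-negative) Wilson action.  In the line this is the
ceiling `c_g·p(g_{K−j})(b₀)² − D ≤ β_K·inf_E A` on the gain constant of any sweep. [cite: Balaban1985UV3, (1)-(3) p.256] -/
theorem action_floor_of_gap {β : ℝ} (hβ : 0 ≤ β) (Ψ' : GaugeField P 0 G → GaugeField P 0 G)
    (E : Set (GaugeField P 0 G)) {m : ℝ} (hgap : ∀ V ∈ E, m ≤ β * (wilsonAction4 V - wilsonAction4 (Ψ' V))) :
    ∀ V ∈ E, m ≤ β * wilsonAction4 V := by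
  intro V hV
  have h0 : 0 ≤ β * wilsonAction4 (Ψ' V) := mul_nonneg hβ (wilsonAction4_nonneg _)
  linarith [(mul_sub β (wilsonAction4 V) (wilsonAction4 (Ψ' V))).symm.le, hgap V hV]

/-- The event misses the open sublevel `{β·A < m}` of the action (contrapositive of `action_floor_of_gap`): ONE configuration of the event
below the floor refutes the gap for these constants. [cite: Balaban1985UV3, (1)-(3) p.256] -/
theorem inter_sublevel_eq_empty_of_gap {β : ℝ} (hβ : 0 ≤ β) (Ψ' : GaugeField P 0 G → GaugeField P 0 G)
    (E : Set (GaugeField P 0 G)) {m : ℝ} (hgap : ∀ V ∈ E, m ≤ β * (wilsonAction4 V - wilsonAction4 (Ψ' V))) :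
    E ∩ {V | β * wilsonAction4 V < m} = ∅ := by
  refine Set.eq_empty_iff_forall_notMem.mpr fun V hV => ?_
  exact absurd (action_floor_of_gap hβ Ψ' E hgap V hV.1) (not_le.mpr hV.2)

/-- **ITERATED FLOOR.**  If the first `k` points `V, Ψ′V, …, Ψ′^{k−1}V` of the `Ψ′`-orbit of `V` lie in the event, the gaps telescope:
`k·m ≤ β·(A(V) − A(Ψ′^{k}V)) ≤ β·A(V)`. [cite: Balaban1985UV3, (1)-(3) p.256] -/
theorem mul_le_action_sub_of_iterate_mem {β : ℝ} (Ψ' : GaugeField P 0 G → GaugeField P 0 G)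
    (E : Set (GaugeField P 0 G)) {m : ℝ} (hgap : ∀ V ∈ E, m ≤ β * (wilsonAction4 V - wilsonAction4 (Ψ' V)))
    (V : GaugeField P 0 G) (k : ℕ) (horbit : ∀ i, i < k → Ψ'^[i] V ∈ E) :
    (k : ℝ) * m ≤ β * (wilsonAction4 V - wilsonAction4 (Ψ'^[k] V)) := by
  induction k with
  | zero => simp
  | succ k ih =>
    have hk : ∀ i, i < k → Ψ'^[i] V ∈ E := fun i hi => horbit i (Nat.lt_succ_of_lt hi)
    have hstep := hgap (Ψ'^[k] V) (horbit k (Nat.lt_succ_self k))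
    rw [← Function.iterate_succ_apply' Ψ' k V] at hstep
    have := ih hk
    push_cast
    nlinarith [this, hstep]

/-- The iterated floor in its crude form `k·m ≤ β·A(V)` (`β ≥ 0`). [cite: Balaban1985UV3, (1)-(3) p.256] -/
theorem mul_le_action_of_iterate_mem {β : ℝ} (hβ : 0 ≤ β) (Ψ' : GaugeField P 0 G → GaugeField P 0 G)
    (E : Set (GaugeField P 0 G)) {m : ℝ} (hgap : ∀ V ∈ E, m ≤ β * (wilsonAction4 V - wilsonAction4 (Ψ' V)))
    (V : GaugeField P 0 G) (k : ℕ) (horbit : ∀ i, i < k → Ψ'^[i] V ∈ E) :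
    (k : ℝ) * m ≤ β * wilsonAction4 V := by
  have h := mul_le_action_sub_of_iterate_mem Ψ' E hgap V k horbit
  have h0 : 0 ≤ β * wilsonAction4 (Ψ'^[k] V) := mul_nonneg hβ (wilsonAction4_nonneg _)
  rw [mul_sub] at h
  linarith

/-- **EXIT TIME.**  For a positive gap `m > 0` the `Ψ′`-orbit of every configuration leaves the event within `⌊β·A(V)/m⌋ + 1` steps: a
discharge cannot recycle the event. [cite: Balaban1985UV3, (1)-(3) p.256] -/
theorem exists_iterate_not_mem {β : ℝ} (hβ : 0 ≤ β) (Ψ' : GaugeField P 0 G → GaugeField P 0 G)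
    (E : Set (GaugeField P 0 G)) {m : ℝ} (hm : 0 < m) (hgap : ∀ V ∈ E, m ≤ β * (wilsonAction4 V - wilsonAction4 (Ψ' V)))
    (V : GaugeField P 0 G) : ∃ k : ℕ, k ≤ ⌊β * wilsonAction4 V / m⌋₊ + 1 ∧ Ψ'^[k] V ∉ E := by
  set k : ℕ := ⌊β * wilsonAction4 V / m⌋₊ + 1 with hk_def
  by_cases hex : ∃ i, i < k ∧ Ψ'^[i] V ∉ E
  · obtain ⟨i, hi, hiE⟩ := hex
    exact ⟨i, hi.le, hiE⟩
  · exfalso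
    have horbit : ∀ i, i < k → Ψ'^[i] V ∈ E := fun i hi => by
      by_contra h
      exact hex ⟨i, hi, h⟩
    have hle := mul_le_action_of_iterate_mem hβ Ψ' E hgap V k horbit
    have hlt : β * wilsonAction4 V / m < k := by
      rw [hk_def]
      push_cast
      exact Nat.lt_floor_add_one _
    have : β * wilsonAction4 V < (k : ℝ) * m := by rwa [div_lt_iff₀ hm] at hlt
    linarith

/-- The measurable GAP-HULL of the event at level `t`: `{m ≤ β(A − A∘Ψ′)} ∩ {A ≤ t}` is measurable, contains `E ∩ {A ≤ t}`, and `Ψ′`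
maps it into the lower sublevel `{A ≤ t − m/β}` (`β > 0`). [cite: Balaban1985UV3, (1)-(3) p.256] -/
theorem gapHull_subset_preimage_sublevel {β : ℝ} (hβ : 0 < β) (Ψ' : GaugeField P 0 G → GaugeField P 0 G) {m : ℝ} (t : ℝ) :
    {V : GaugeField P 0 G | m ≤ β * (wilsonAction4 V - wilsonAction4 (Ψ' V))} ∩ {V | wilsonAction4 V ≤ t} ⊆
      Ψ' ⁻¹' {W | wilsonAction4 W ≤ t - m / β} := by
  intro V hV
  have h1 : m ≤ β * (wilsonAction4 V - wilsonAction4 (Ψ' V)) := hV.1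
  have h2 : wilsonAction4 V ≤ t := hV.2
  show wilsonAction4 (Ψ' V) ≤ t - m / β
  rw [le_sub_iff_add_le, ← le_sub_iff_add_le', div_le_iff₀ hβ]
  rw [mul_sub] at h1
  nlinarith [h1, h2, hβ]

end Floor

section Haar

variable {P : Params} {G : Type*} [GaugeGroup G] [MeasurableSpace G] [HaarData G] [RegularGaugeGroup G]

omit [RegularGaugeGroup G] in
/-- The inverse `Ψ′` of a `dU`-preserving measurable bijection `Ψ` with measurable inverse is `dU`-preserving. [cite: Balaban1985Averaging, (10) p.19] -/
theorem measurePreserving_inverse {Ψ Ψ' : GaugeField P 0 G → GaugeField P 0 G}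
    (hΨ : MeasurePreserving Ψ (fieldMeasure P 0 G) (fieldMeasure P 0 G)) (hΨ' : Measurable Ψ')
    (h₁ : Function.LeftInverse Ψ' Ψ) (h₂ : Function.RightInverse Ψ' Ψ) :
    MeasurePreserving Ψ' (fieldMeasure P 0 G) (fieldMeasure P 0 G) := by
  let Te : GaugeField P 0 G ≃ᵐ GaugeField P 0 G :=
    { toFun := Ψ, invFun := Ψ', left_inv := h₁, right_inv := h₂, measurable_toFun := hΨ.measurable,
      measurable_invFun := hΨ' }
  have hTe : MeasurePreserving Te (fieldMeasure P 0 G) (fieldMeasure P 0 G) := hΨ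
  exact hTe.symm

/-- **HAAR SUBLEVEL DOMINATION.**  For `β > 0`, a `dU`-preserving measurable bijection `(Ψ, Ψ′)` and ANY event `E` with gap
`m ≤ β(A(V) − A(Ψ′V))` on `E`: at EVERY level `t`, `dU(E ∩ {A ≤ t}) ≤ dU({A ≤ t − m/β})` — `Ψ′` carries the (measurable gap-hull of the)
event injectively and `dU`-preservingly into the lower sublevel.  This is the Haar-volume comparison any pure-`∃Ψ′` gap text asserts,
displayed one level at a time; `t < m/β` recovers the floor (`dU(E ∩ {A ≤ t}) = 0`). [cite: Balaban1985Averaging, (10) p.19] -/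
theorem measureReal_fieldMeasure_inter_sublevel_le_of_gap {β : ℝ} (hβ : 0 < β) {Ψ Ψ' : GaugeField P 0 G → GaugeField P 0 G}
    (hΨ : MeasurePreserving Ψ (fieldMeasure P 0 G) (fieldMeasure P 0 G)) (hΨ' : Measurable Ψ')
    (h₁ : Function.LeftInverse Ψ' Ψ) (h₂ : Function.RightInverse Ψ' Ψ) (E : Set (GaugeField P 0 G)) {m : ℝ}
    (hgap : ∀ V ∈ E, m ≤ β * (wilsonAction4 V - wilsonAction4 (Ψ' V))) (t : ℝ) :
    (fieldMeasure P 0 G).real (E ∩ {V | wilsonAction4 V ≤ t}) ≤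
      (fieldMeasure P 0 G).real {V | wilsonAction4 V ≤ t - m / β} := by
  haveI : IsProbabilityMeasure (fieldMeasure P 0 G) := isProbabilityMeasure_fieldMeasure (G := G) P 0
  have hΨ'p := measurePreserving_inverse hΨ hΨ' h₁ h₂
  have hA4 := measurable_wilsonAction4 (P := P) (j := 0) (RegularGaugeGroup.measurable_reTr (G := G))
  set B : Set (GaugeField P 0 G) :=
    {V | m ≤ β * (wilsonAction4 V - wilsonAction4 (Ψ' V))} ∩ {V | wilsonAction4 V ≤ t} with hB_def
  have hEB : E ∩ {V | wilsonAction4 V ≤ t} ⊆ B := fun V hV => ⟨hgap V hV.1, hV.2⟩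
  have hC : MeasurableSet {W : GaugeField P 0 G | wilsonAction4 W ≤ t - m / β} := measurableSet_le hA4 measurable_const
  have hBC : B ⊆ Ψ' ⁻¹' {W | wilsonAction4 W ≤ t - m / β} := gapHull_subset_preimage_sublevel hβ Ψ' t
  calc (fieldMeasure P 0 G).real (E ∩ {V | wilsonAction4 V ≤ t})
      ≤ (fieldMeasure P 0 G).real (Ψ' ⁻¹' {W | wilsonAction4 W ≤ t - m / β}) :=
        measureReal_mono (hEB.trans hBC) (measure_ne_top _ _)
    _ = (fieldMeasure P 0 G).real {W | wilsonAction4 W ≤ t - m / β} := by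
        rw [measureReal_def, measureReal_def, hΨ'p.measure_preimage hC.nullMeasurableSet]

/-- **GIBBS SUBLEVEL DOMINATION** (action-localised tail corollary).  Same hypotheses, `μ_β = gibbsMeasure P β`: at EVERY level `t`,
`μ_β(E ∩ {A ≤ t}) ≤ e^{−m}·μ_β({A ≤ t − m/β})`.  The reweighting identity on the gap-hull gives the factor `e^{−m}` and the pre-image
`Ψ⁻¹(hull)` lies in the lower sublevel; `t → ∞` is the landed `μ_β(E) ≤ e^{−m}`. [cite: Balaban1985UV3, (1)-(3) p.256] -/
theorem measureReal_gibbsMeasure_inter_sublevel_le_of_gap {β : ℝ} (hβ : 0 < β) {Ψ Ψ' : GaugeField P 0 G → GaugeField P 0 G}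
    (hΨ : MeasurePreserving Ψ (fieldMeasure P 0 G) (fieldMeasure P 0 G)) (hΨ' : Measurable Ψ')
    (h₁ : Function.LeftInverse Ψ' Ψ) (h₂ : Function.RightInverse Ψ' Ψ) (E : Set (GaugeField P 0 G)) {m : ℝ}
    (hgap : ∀ V ∈ E, m ≤ β * (wilsonAction4 V - wilsonAction4 (Ψ' V))) (t : ℝ) :
    (T4GenFunBounds.gibbsMeasure P β).real (E ∩ {V | wilsonAction4 V ≤ t}) ≤
      Real.exp (-m) * (T4GenFunBounds.gibbsMeasure P β).real {V : GaugeField P 0 G | wilsonAction4 V ≤ t - m / β} := by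
  haveI := T4GenFunBounds.isProbabilityMeasure_gibbsMeasure (G := G) P hβ.le
  have hA4 := measurable_wilsonAction4 (P := P) (j := 0) (RegularGaugeGroup.measurable_reTr (G := G))
  set B : Set (GaugeField P 0 G) :=
    {V | m ≤ β * (wilsonAction4 V - wilsonAction4 (Ψ' V))} ∩ {V | wilsonAction4 V ≤ t} with hB_def
  have hBm : MeasurableSet B :=
    (measurableSet_le measurable_const ((hA4.sub (hA4.comp hΨ')).const_mul β)).inter (measurableSet_le hA4 measurable_const)
  have hEB : E ∩ {V | wilsonAction4 V ≤ t} ⊆ B := fun V hV => ⟨hgap V hV.1, hV.2⟩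
  -- gap in pre-image form on the hull
  have hgapB : ∀ U, Ψ U ∈ B → m ≤ β * (wilsonAction4 (Ψ U) - wilsonAction4 U) := by
    intro U hU
    have h : m ≤ β * (wilsonAction4 (Ψ U) - wilsonAction4 (Ψ' (Ψ U))) := hU.1
    rwa [h₁ U] at h
  -- the pre-image of the hull lies in the lower sublevel
  have hpre : Ψ ⁻¹' B ⊆ {V | wilsonAction4 V ≤ t - m / β} := by
    intro U hU
    have hU' : Ψ U ∈ B := hU
    have h := gapHull_subset_preimage_sublevel hβ Ψ' t hU'
    simpa only [Set.mem_preimage, h₁ U, Set.mem_setOf_eq] using h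
  calc (T4GenFunBounds.gibbsMeasure P β).real (E ∩ {V | wilsonAction4 V ≤ t})
      ≤ (T4GenFunBounds.gibbsMeasure P β).real B := measureReal_mono hEB (measure_ne_top _ _)
    _ ≤ Real.exp (-m) * (T4GenFunBounds.gibbsMeasure P β).real (Ψ ⁻¹' B) :=
        measureReal_gibbsMeasure_le_exp_neg_mul hβ.le hΨ hΨ' h₁ h₂ hBm hgapB
    _ ≤ Real.exp (-m) * (T4GenFunBounds.gibbsMeasure P β).real {V | wilsonAction4 V ≤ t - m / β} :=
        mul_le_mul_of_nonneg_left (measureReal_mono hpre (measure_ne_top _ _)) (Real.exp_nonneg _)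

end Haar

section GibbsK

variable (F : T3Family) {G : Type*} [GaugeGroup G] [MeasurableSpace G] [HaarData G] [RegularGaugeGroup G]
  (ℰ : LoopAverage G) {γ : ℝ}

omit [MeasurableSpace G] [HaarData G] [RegularGaugeGroup G] in
/-- `β_K = (γ ε_K)⁻¹ > 0` on a Bałaban family for `γ > 0`. [cite: Balaban1985UV3, (1)-(3) p.256] -/
theorem scheme_β_pos (hγ : 0 < γ) (K : ℕ) : 0 < (F.scheme ℰ γ).β K :=
  inv_pos.mpr (mul_pos hγ (F.P K).eps_pos)

omit [MeasurableSpace G] [HaarData G] [RegularGaugeGroup G] in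
/-- The action floor at `T3UnitScaleTilt.gibbsK`'s inverse coupling `β_K` (`γ ≥ 0`). [cite: Balaban1985UV3, (1)-(3) p.256] -/
theorem action_floor_of_gapK (hγ : 0 ≤ γ) (K : ℕ) (Ψ' : GaugeField (F.P K) 0 G → GaugeField (F.P K) 0 G)
    (E : Set (GaugeField (F.P K) 0 G)) {m : ℝ}
    (hgap : ∀ V ∈ E, m ≤ (F.scheme ℰ γ).β K * (wilsonAction4 V - wilsonAction4 (Ψ' V))) :
    ∀ V ∈ E, m ≤ (F.scheme ℰ γ).β K * wilsonAction4 V :=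
  action_floor_of_gap (F.scheme_β_nonneg ℰ hγ K) Ψ' E hgap

/-- Gibbs sublevel domination for `gibbsK F ℰ γ K` (`γ > 0`): `Gibbs_K(E ∩ {A ≤ t}) ≤ e^{−m}·Gibbs_K({A ≤ t − m/β_K})`.
[cite: Balaban1985UV3, (1)-(3) p.256] -/
theorem gibbsK_real_inter_sublevel_le_of_gap (hγ : 0 < γ) (K : ℕ) {Ψ Ψ' : GaugeField (F.P K) 0 G → GaugeField (F.P K) 0 G}
    (hΨ : MeasurePreserving Ψ (fieldMeasure (F.P K) 0 G) (fieldMeasure (F.P K) 0 G)) (hΨ' : Measurable Ψ')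
    (h₁ : Function.LeftInverse Ψ' Ψ) (h₂ : Function.RightInverse Ψ' Ψ) (E : Set (GaugeField (F.P K) 0 G)) {m : ℝ}
    (hgap : ∀ V ∈ E, m ≤ (F.scheme ℰ γ).β K * (wilsonAction4 V - wilsonAction4 (Ψ' V))) (t : ℝ) :
    (gibbsK F ℰ γ K).real (E ∩ {V | wilsonAction4 V ≤ t}) ≤
      Real.exp (-m) * (gibbsK F ℰ γ K).real {V | wilsonAction4 V ≤ t - m / (F.scheme ℰ γ).β K} := by
  rw [gibbsK_eq]
  exact measureReal_gibbsMeasure_inter_sublevel_le_of_gap (scheme_β_pos F ℰ hγ K) hΨ hΨ' h₁ h₂ E hgap t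

/-- Haar sublevel domination on the level-`K` fine fields of a Bałaban family (`γ > 0`). [cite: Balaban1985Averaging, (10) p.19] -/
theorem fieldMeasure_real_inter_sublevel_le_of_gapK (hγ : 0 < γ) (K : ℕ) {Ψ Ψ' : GaugeField (F.P K) 0 G → GaugeField (F.P K) 0 G}
    (hΨ : MeasurePreserving Ψ (fieldMeasure (F.P K) 0 G) (fieldMeasure (F.P K) 0 G)) (hΨ' : Measurable Ψ')
    (h₁ : Function.LeftInverse Ψ' Ψ) (h₂ : Function.RightInverse Ψ' Ψ) (E : Set (GaugeField (F.P K) 0 G)) {m : ℝ}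
    (hgap : ∀ V ∈ E, m ≤ (F.scheme ℰ γ).β K * (wilsonAction4 V - wilsonAction4 (Ψ' V))) (t : ℝ) :
    (fieldMeasure (F.P K) 0 G).real (E ∩ {V | wilsonAction4 V ≤ t}) ≤
      (fieldMeasure (F.P K) 0 G).real {V | wilsonAction4 V ≤ t - m / (F.scheme ℰ γ).β K} :=
  measureReal_fieldMeasure_inter_sublevel_le_of_gap (scheme_β_pos F ℰ hγ K) hΨ hΨ' h₁ h₂ E hgap t

end GibbsK

/-! ## §2 The registered text's price: the sandwich-window event carries a deterministic action floor -/

section Registered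

/-- **THE ACTION FLOOR FORCED BY THE REGISTERED STUB `stub_sandwichSweepGapCapped`** (skeleton v5 of
`Cruxes/HistoryTailL/Lines/sandwich_discharge.lean`, registered 2026-08-29T08:38Z; the v4 text `stub_sandwichSweepGap` is the same without the
severity cap `b ≤ 2(151L²)^j b₀`).  Hypothesis: the registered signature VERBATIM.  Conclusion: the same quantifier prefix, and for every
configuration `V` of the sandwich-window event «finer heights θ(b)-small ∧ coarser heights `j′ ∈ [j, K−n]` θ(Λb)-small ∧
`(1−δ²/2)·θ(b)(K−j)·√(1−θ(Λb)(K−j)²/4) ≤ ⟨v, Im q(Ū^j(V)(∂p))⟩`» the DETERMINISTIC floor `c_g·p(g_{K−j})(b₀)² − D ≤ β_K·A(V)`.  Any inhabitant of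
the registered text delivers this for free; one configuration of the event below the floor refutes those constants.
[cite: Balaban1985UV3, (1)-(3) p.256 and (7) p.257] -/
theorem actionFloor_of_sweepGapCappedText
    (hG : ∀ (L : ℕ), ∃ N₁ : ℕ, 0 < N₁ ∧ ∀ (b₀ p₀ Λ : ℝ), 0 < b₀ → 2 < p₀ → 1 < Λ →
      ∃ (j₀ : ℕ) (γ₁ cg D δ : ℝ), 0 < γ₁ ∧ γ₁ ≤ 1 ∧ 0 < cg ∧ 0 < δ ∧ δ ^ 2 ≤ 2 ∧
        ∀ (F : T3Family) (γ : ℝ), F.L = L → 0 < γ → γ ≤ γ₁ → ∀ (b : ℝ), b₀ ≤ b → ∀ (K n j : ℕ), j₀ < j → N₁ * j + n ≤ K →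
          b ≤ 2 * (151 * (F.L : ℝ) ^ 2) ^ j * b₀ → T3UnitScaleTilt.θBal F.L γ (Λ * b) p₀ (K - j) ≤ 1 → ∀ (p : Plaq (F.P K) j) (v : EuclideanSpace ℝ (Fin 3)), ‖v‖ = 1 →
            ∃ (Ψ Ψ' : GaugeField (F.P K) 0 (Matrix.specialUnitaryGroup (Fin 2) ℂ) → GaugeField (F.P K) 0 (Matrix.specialUnitaryGroup (Fin 2) ℂ)),
              MeasurePreserving Ψ (fieldMeasure (F.P K) 0 (Matrix.specialUnitaryGroup (Fin 2) ℂ)) (fieldMeasure (F.P K) 0 (Matrix.specialUnitaryGroup (Fin 2) ℂ)) ∧ Measurable Ψ' ∧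
              Function.LeftInverse Ψ' Ψ ∧ Function.RightInverse Ψ' Ψ ∧
              ∀ V : GaugeField (F.P K) 0 (Matrix.specialUnitaryGroup (Fin 2) ℂ),
                (∀ k, k < j → PlaqSmall (T3UnitScaleTilt.θBal F.L γ b p₀ (K - k))
                  (Averaging.iter (fun i => BlockAveraging.blockAvg (P := F.P K) (j := i) T3UnitLawDensityEML.ℰp) k V)) →
                (∀ j', j ≤ j' → j' + n ≤ K → PlaqSmall (T3UnitScaleTilt.θBal F.L γ (Λ * b) p₀ (K - j'))
                  (Averaging.iter (fun i => BlockAveraging.blockAvg (P := F.P K) (j := i) T3UnitLawDensityEML.ℰp) j' V)) →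
                (1 - δ ^ 2 / 2) * (T3UnitScaleTilt.θBal F.L γ b p₀ (K - j) *
                    Real.sqrt (1 - T3UnitScaleTilt.θBal F.L γ (Λ * b) p₀ (K - j) ^ 2 / 4)) ≤
                  ⟪v, T4ExpWindowSmallField.imVec (Literature.MathematicalPhysics.QuantumLattice.su2Quat (GaugeField.plaqHol
                    (Averaging.iter (fun i => BlockAveraging.blockAvg (P := F.P K) (j := i) T3UnitLawDensityEML.ℰp) j V) p))⟫ →
                cg * B10.pFun b₀ p₀ (Real.sqrt (γ * ((F.L : ℝ)⁻¹) ^ (K - j))) ^ 2 - D ≤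
                  (F.scheme T3UnitLawDensityEML.ℰp γ).β K * (wilsonAction4 V - wilsonAction4 (Ψ' V))) :
    ∀ (L : ℕ), ∃ N₁ : ℕ, 0 < N₁ ∧ ∀ (b₀ p₀ Λ : ℝ), 0 < b₀ → 2 < p₀ → 1 < Λ →
      ∃ (j₀ : ℕ) (γ₁ cg D δ : ℝ), 0 < γ₁ ∧ γ₁ ≤ 1 ∧ 0 < cg ∧ 0 < δ ∧ δ ^ 2 ≤ 2 ∧
        ∀ (F : T3Family) (γ : ℝ), F.L = L → 0 < γ → γ ≤ γ₁ → ∀ (b : ℝ), b₀ ≤ b → ∀ (K n j : ℕ), j₀ < j → N₁ * j + n ≤ K →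
          b ≤ 2 * (151 * (F.L : ℝ) ^ 2) ^ j * b₀ → T3UnitScaleTilt.θBal F.L γ (Λ * b) p₀ (K - j) ≤ 1 → ∀ (p : Plaq (F.P K) j) (v : EuclideanSpace ℝ (Fin 3)), ‖v‖ = 1 →
            ∀ V : GaugeField (F.P K) 0 (Matrix.specialUnitaryGroup (Fin 2) ℂ),
              (∀ k, k < j → PlaqSmall (T3UnitScaleTilt.θBal F.L γ b p₀ (K - k))
                (Averaging.iter (fun i => BlockAveraging.blockAvg (P := F.P K) (j := i) T3UnitLawDensityEML.ℰp) k V)) →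
              (∀ j', j ≤ j' → j' + n ≤ K → PlaqSmall (T3UnitScaleTilt.θBal F.L γ (Λ * b) p₀ (K - j'))
                (Averaging.iter (fun i => BlockAveraging.blockAvg (P := F.P K) (j := i) T3UnitLawDensityEML.ℰp) j' V)) →
              (1 - δ ^ 2 / 2) * (T3UnitScaleTilt.θBal F.L γ b p₀ (K - j) *
                  Real.sqrt (1 - T3UnitScaleTilt.θBal F.L γ (Λ * b) p₀ (K - j) ^ 2 / 4)) ≤
                ⟪v, T4ExpWindowSmallField.imVec (Literature.MathematicalPhysics.QuantumLattice.su2Quat (GaugeField.plaqHol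
                  (Averaging.iter (fun i => BlockAveraging.blockAvg (P := F.P K) (j := i) T3UnitLawDensityEML.ℰp) j V) p))⟫ →
              cg * B10.pFun b₀ p₀ (Real.sqrt (γ * ((F.L : ℝ)⁻¹) ^ (K - j))) ^ 2 - D ≤
                (F.scheme T3UnitLawDensityEML.ℰp γ).β K * wilsonAction4 V := by
  intro L
  obtain ⟨N₁, hN₁, hG₁⟩ := hG L
  refine ⟨N₁, hN₁, fun b₀ p₀ Λ hb₀ hp₀ hΛ => ?_⟩
  obtain ⟨j₀, γ₁, cg, D, δ, hγ₁, hγ₁1, hcg, hδ, hδ2, hG₂⟩ := hG₁ b₀ p₀ Λ hb₀ hp₀ hΛ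
  refine ⟨j₀, γ₁, cg, D, δ, hγ₁, hγ₁1, hcg, hδ, hδ2, ?_⟩
  intro F γ hFL hγ hγ1 b hb K n j hj hjK hcap hsm p v hv V hfin hco hwin
  obtain ⟨Ψ, Ψ', _hΨ, _hΨ', _h₁, _h₂, hgap⟩ := hG₂ F γ hFL hγ hγ1 b hb K n j hj hjK hcap hsm p v hv
  set E : Set (GaugeField (F.P K) 0 SU2) :=
    {V | (∀ k, k < j → PlaqSmall (T3UnitScaleTilt.θBal F.L γ b p₀ (K - k))
        (Averaging.iter (fun i => BlockAveraging.blockAvg (P := F.P K) (j := i) ℰp) k V)) ∧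
      (∀ j', j ≤ j' → j' + n ≤ K → PlaqSmall (T3UnitScaleTilt.θBal F.L γ (Λ * b) p₀ (K - j'))
        (Averaging.iter (fun i => BlockAveraging.blockAvg (P := F.P K) (j := i) ℰp) j' V)) ∧
      (1 - δ ^ 2 / 2) * (T3UnitScaleTilt.θBal F.L γ b p₀ (K - j) *
          Real.sqrt (1 - T3UnitScaleTilt.θBal F.L γ (Λ * b) p₀ (K - j) ^ 2 / 4)) ≤
        ⟪v, imVec (su2Quat (GaugeField.plaqHol
          (Averaging.iter (fun i => BlockAveraging.blockAvg (P := F.P K) (j := i) ℰp) j V) p))⟫} with hE_def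
  have hgapE : ∀ W ∈ E, cg * B10.pFun b₀ p₀ (Real.sqrt (γ * ((F.L : ℝ)⁻¹) ^ (K - j))) ^ 2 - D ≤
      (F.scheme ℰp γ).β K * (wilsonAction4 W - wilsonAction4 (Ψ' W)) :=
    fun W hW => hgap W hW.1 hW.2.1 hW.2.2
  exact action_floor_of_gapK F ℰp hγ.le K Ψ' E hgapE V ⟨hfin, hco, hwin⟩

/-- **THE ACTION-LOCALISED TAIL FORCED BY THE REGISTERED STUB `stub_sandwichSweepGapCapped`.**  Same hypothesis; conclusion: for every
level `t` the sandwich-window event obeys `Gibbs_K(E_v ∩ {A ≤ t}) ≤ e^{D}·e^{−c_g·p(g_{K−j})(b₀)²}·Gibbs_K({A ≤ t − (c_g·p² − D)/β_K})` (`t → ∞`: the landed per-direction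
tail of `CovariantDischargeSweepGapReduction` §1). [cite: Balaban1985UV3, (1)-(3) p.256 and (7) p.257] -/
theorem gibbsK_inter_sublevel_le_of_sweepGapCappedText
    (hG : ∀ (L : ℕ), ∃ N₁ : ℕ, 0 < N₁ ∧ ∀ (b₀ p₀ Λ : ℝ), 0 < b₀ → 2 < p₀ → 1 < Λ →
      ∃ (j₀ : ℕ) (γ₁ cg D δ : ℝ), 0 < γ₁ ∧ γ₁ ≤ 1 ∧ 0 < cg ∧ 0 < δ ∧ δ ^ 2 ≤ 2 ∧
        ∀ (F : T3Family) (γ : ℝ), F.L = L → 0 < γ → γ ≤ γ₁ → ∀ (b : ℝ), b₀ ≤ b → ∀ (K n j : ℕ), j₀ < j → N₁ * j + n ≤ K →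
          b ≤ 2 * (151 * (F.L : ℝ) ^ 2) ^ j * b₀ → T3UnitScaleTilt.θBal F.L γ (Λ * b) p₀ (K - j) ≤ 1 → ∀ (p : Plaq (F.P K) j) (v : EuclideanSpace ℝ (Fin 3)), ‖v‖ = 1 →
            ∃ (Ψ Ψ' : GaugeField (F.P K) 0 (Matrix.specialUnitaryGroup (Fin 2) ℂ) → GaugeField (F.P K) 0 (Matrix.specialUnitaryGroup (Fin 2) ℂ)),
              MeasurePreserving Ψ (fieldMeasure (F.P K) 0 (Matrix.specialUnitaryGroup (Fin 2) ℂ)) (fieldMeasure (F.P K) 0 (Matrix.specialUnitaryGroup (Fin 2) ℂ)) ∧ Measurable Ψ' ∧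
              Function.LeftInverse Ψ' Ψ ∧ Function.RightInverse Ψ' Ψ ∧
              ∀ V : GaugeField (F.P K) 0 (Matrix.specialUnitaryGroup (Fin 2) ℂ),
                (∀ k, k < j → PlaqSmall (T3UnitScaleTilt.θBal F.L γ b p₀ (K - k))
                  (Averaging.iter (fun i => BlockAveraging.blockAvg (P := F.P K) (j := i) T3UnitLawDensityEML.ℰp) k V)) →
                (∀ j', j ≤ j' → j' + n ≤ K → PlaqSmall (T3UnitScaleTilt.θBal F.L γ (Λ * b) p₀ (K - j'))
                  (Averaging.iter (fun i => BlockAveraging.blockAvg (P := F.P K) (j := i) T3UnitLawDensityEML.ℰp) j' V)) →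
                (1 - δ ^ 2 / 2) * (T3UnitScaleTilt.θBal F.L γ b p₀ (K - j) *
                    Real.sqrt (1 - T3UnitScaleTilt.θBal F.L γ (Λ * b) p₀ (K - j) ^ 2 / 4)) ≤
                  ⟪v, T4ExpWindowSmallField.imVec (Literature.MathematicalPhysics.QuantumLattice.su2Quat (GaugeField.plaqHol
                    (Averaging.iter (fun i => BlockAveraging.blockAvg (P := F.P K) (j := i) T3UnitLawDensityEML.ℰp) j V) p))⟫ →
                cg * B10.pFun b₀ p₀ (Real.sqrt (γ * ((F.L : ℝ)⁻¹) ^ (K - j))) ^ 2 - D ≤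
                  (F.scheme T3UnitLawDensityEML.ℰp γ).β K * (wilsonAction4 V - wilsonAction4 (Ψ' V))) :
    ∀ (L : ℕ), ∃ N₁ : ℕ, 0 < N₁ ∧ ∀ (b₀ p₀ Λ : ℝ), 0 < b₀ → 2 < p₀ → 1 < Λ →
      ∃ (j₀ : ℕ) (γ₁ cg D δ : ℝ), 0 < γ₁ ∧ γ₁ ≤ 1 ∧ 0 < cg ∧ 0 < δ ∧ δ ^ 2 ≤ 2 ∧
        ∀ (F : T3Family) (γ : ℝ), F.L = L → 0 < γ → γ ≤ γ₁ → ∀ (b : ℝ), b₀ ≤ b → ∀ (K n j : ℕ), j₀ < j → N₁ * j + n ≤ K →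
          b ≤ 2 * (151 * (F.L : ℝ) ^ 2) ^ j * b₀ → T3UnitScaleTilt.θBal F.L γ (Λ * b) p₀ (K - j) ≤ 1 → ∀ (p : Plaq (F.P K) j) (v : EuclideanSpace ℝ (Fin 3)), ‖v‖ = 1 →
            ∀ t : ℝ,
              (T3UnitScaleTilt.gibbsK F T3UnitLawDensityEML.ℰp γ K).real
                ({V : GaugeField (F.P K) 0 (Matrix.specialUnitaryGroup (Fin 2) ℂ) |
                  (∀ k, k < j → PlaqSmall (T3UnitScaleTilt.θBal F.L γ b p₀ (K - k))
                    (Averaging.iter (fun i => BlockAveraging.blockAvg (P := F.P K) (j := i) T3UnitLawDensityEML.ℰp) k V)) ∧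
                  (∀ j', j ≤ j' → j' + n ≤ K → PlaqSmall (T3UnitScaleTilt.θBal F.L γ (Λ * b) p₀ (K - j'))
                    (Averaging.iter (fun i => BlockAveraging.blockAvg (P := F.P K) (j := i) T3UnitLawDensityEML.ℰp) j' V)) ∧
                  (1 - δ ^ 2 / 2) * (T3UnitScaleTilt.θBal F.L γ b p₀ (K - j) *
                      Real.sqrt (1 - T3UnitScaleTilt.θBal F.L γ (Λ * b) p₀ (K - j) ^ 2 / 4)) ≤
                    ⟪v, T4ExpWindowSmallField.imVec (Literature.MathematicalPhysics.QuantumLattice.su2Quat (GaugeField.plaqHol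
                      (Averaging.iter (fun i => BlockAveraging.blockAvg (P := F.P K) (j := i) T3UnitLawDensityEML.ℰp) j V) p))⟫} ∩
                  {V | wilsonAction4 V ≤ t}) ≤
              Real.exp D * Real.exp (-(cg * B10.pFun b₀ p₀ (Real.sqrt (γ * ((F.L : ℝ)⁻¹) ^ (K - j))) ^ 2)) *
                (T3UnitScaleTilt.gibbsK F T3UnitLawDensityEML.ℰp γ K).real
                  {V | wilsonAction4 V ≤ t - (cg * B10.pFun b₀ p₀ (Real.sqrt (γ * ((F.L : ℝ)⁻¹) ^ (K - j))) ^ 2 - D) /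
                    (F.scheme T3UnitLawDensityEML.ℰp γ).β K} := by
  intro L
  obtain ⟨N₁, hN₁, hG₁⟩ := hG L
  refine ⟨N₁, hN₁, fun b₀ p₀ Λ hb₀ hp₀ hΛ => ?_⟩
  obtain ⟨j₀, γ₁, cg, D, δ, hγ₁, hγ₁1, hcg, hδ, hδ2, hG₂⟩ := hG₁ b₀ p₀ Λ hb₀ hp₀ hΛ
  refine ⟨j₀, γ₁, cg, D, δ, hγ₁, hγ₁1, hcg, hδ, hδ2, ?_⟩
  intro F γ hFL hγ hγ1 b hb K n j hj hjK hcap hsm p v hv t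
  obtain ⟨Ψ, Ψ', hΨ, hΨ', h₁, h₂, hgap⟩ := hG₂ F γ hFL hγ hγ1 b hb K n j hj hjK hcap hsm p v hv
  set m : ℝ := cg * B10.pFun b₀ p₀ (Real.sqrt (γ * ((F.L : ℝ)⁻¹) ^ (K - j))) ^ 2 - D with hm_def
  set E : Set (GaugeField (F.P K) 0 SU2) :=
    {V | (∀ k, k < j → PlaqSmall (T3UnitScaleTilt.θBal F.L γ b p₀ (K - k))
        (Averaging.iter (fun i => BlockAveraging.blockAvg (P := F.P K) (j := i) ℰp) k V)) ∧
      (∀ j', j ≤ j' → j' + n ≤ K → PlaqSmall (T3UnitScaleTilt.θBal F.L γ (Λ * b) p₀ (K - j'))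
        (Averaging.iter (fun i => BlockAveraging.blockAvg (P := F.P K) (j := i) ℰp) j' V)) ∧
      (1 - δ ^ 2 / 2) * (T3UnitScaleTilt.θBal F.L γ b p₀ (K - j) *
          Real.sqrt (1 - T3UnitScaleTilt.θBal F.L γ (Λ * b) p₀ (K - j) ^ 2 / 4)) ≤
        ⟪v, imVec (su2Quat (GaugeField.plaqHol
          (Averaging.iter (fun i => BlockAveraging.blockAvg (P := F.P K) (j := i) ℰp) j V) p))⟫} with hE_def
  have hgapE : ∀ W ∈ E, m ≤ (F.scheme ℰp γ).β K * (wilsonAction4 W - wilsonAction4 (Ψ' W)) :=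
    fun W hW => hgap W hW.1 hW.2.1 hW.2.2
  have hmain := gibbsK_real_inter_sublevel_le_of_gap F ℰp hγ K hΨ hΨ' h₁ h₂ E hgapE t
  refine hmain.trans (le_of_eq ?_)
  rw [hm_def, ← Real.exp_add]
  congr 2
  ring

end Registered

end Summit.QuantumFields.YangMills.Theorems.CovariantDischargeSweepGapNecessary

end
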